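import Literature.Computability.Cryptography.LeftoverHashLemma
import HarnessLib

/-!
# A joint Leftover Hash Lemma: hashing `x` and `f(x)` with independent pairwise independent families

Companion of `LeftoverHashLemma.lean` (collision-probability form of the Leftover Hash Lemma,
Arora–Barak 2009, Lemma 21.26). For the density step of Liu–Pass's Lemma 5.3 (FOCS 2020,
arXiv:2009.11514, Appendix: the "massaged" function
`f̂(x, σ₁, σ₂) = σ₁ ‖ σ₂ ‖ [h_{σ₁}(x)]_a ‖ [h_{σ₂}(f(x))]_b` is close to uniform) the printed proof
applies the LHL twice — to `x` given `f(x)` and to `f(x)` — losing a factor `2^{d/4}` in each step.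
This file proves the **one-shot** collision bound for the doubly keyed map
`((k₁,k₂), x) ↦ ((k₁,k₂), h¹_{k₁}(x), h²_{k₂}(f x))` on `(K₁ × K₂) × S`, `X` uniform on `S`:

  `#collisions · |γ₁||γ₂| ≤ |K₁||K₂| · (|S||γ₁||γ₂| + C_f |γ₂| + |S|²)`   (`card_collisions_keyed₂_mul_le`)

where `C_f = #{(x,x') ∈ S² : x ≠ x', f x = f x'}` (`fibreColl`) counts the same-fibre pairs (for
these the second hash always collides, the first collides with probability `1/|γ₁|`; for pairs in
different fibres both hashes collide independently), whence (`distUnif_le_sqrt`)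

  `Δ(((K, h¹_K(X), h²_K(f X))), U) ≤ ½ √((|γ₁||γ₂| + |γ₂|·M) / |S|)`   (`leftoverHash_joint`)

for any `M` with `C_f ≤ |S|·M`, e.g. `M + 1 ≥` the largest fibre of `f` in `S` (`fibreColl_le`).
With `|S| ≥ 2^s`, `|γ₁| = 2^a`, `|γ₂| = 2^b`, fibres `≤ 2^r` and `a + b = s − 2t`, `b + r ≤ s − 2t`
this is `≤ 2^{−1/2} · 2^{−t}` — the square of the printed two-step bound. The sharp form
(`card_collisions_keyed₂_sharp`, `leftoverHash_joint_sharp`: `(|γ₂| − 1)·M` in place of `|γ₂|·M`)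
books the pairs in distinct fibres exactly; it is the form needed when `|γ₂| = 1`. All statements
proved, Mathlib only (via `LeftoverHashLemma.lean`).

## References

* S. Arora, B. Barak, *Computational Complexity: A Modern Approach*, CUP 2009, Lemma 21.26 and
  its proof (collision probability), §8.2.2 (pairwise independent families).
* J. Håstad, R. Impagliazzo, L. A. Levin, M. Luby, *A pseudorandom generator from any one-way
  function*, SIAM J. Comput. 28 (1999), Lemma 4.8 (Leftover Hash Lemma).
* Y. Liu, R. Pass, *On one-way functions and Kolmogorov complexity*, FOCS 2020
  (arXiv:2009.11514), Appendix (proof of Lemma 5.3: `REAL`, `HYB₁`, `HYB₂`).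
-/

namespace Literature.Computability.Cryptography

namespace LeftoverHash

open Finset

section Joint

variable {ι β κ₁ κ₂ γ₁ γ₂ : Type*}

/-- The doubly keyed map `((k₁, k₂), x) ↦ ((k₁, k₂), (h¹_{k₁} x, h²_{k₂} (f x)))`: hash the point
with the first family and its image under `f` with the second. [Y. Liu, R. Pass, FOCS 2020,
Appendix (proof of Lemma 5.3, `REAL`)] [folklore] -/
def keyed₂ (h₁ : κ₁ → ι → γ₁) (h₂ : κ₂ → β → γ₂) (f : ι → β) (p : (κ₁ × κ₂) × ι) : (κ₁ × κ₂) × (γ₁ × γ₂) :=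
  (p.1, (h₁ p.1.1 p.2, h₂ p.1.2 (f p.2)))

variable [DecidableEq ι] [DecidableEq β]

/-- **Same-fibre pairs** `C_f = #{(x, x') ∈ S × S : x ≠ x', f x = f x'}`. [folklore] -/
def fibreColl (S : Finset ι) (f : ι → β) : ℕ := ((S ×ˢ S).filter fun p => p.1 ≠ p.2 ∧ f p.1 = f p.2).card

/-- If every fibre of `f` inside `S` has at most `M + 1` points then `C_f ≤ |S| · M`. [folklore] -/
theorem fibreColl_le {S : Finset ι} {f : ι → β} {M : ℕ} (hM : ∀ x ∈ S, (S.filter fun x' => f x' = f x).card ≤ M + 1) :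
    fibreColl S f ≤ S.card * M := by
  classical
  unfold fibreColl
  rw [Finset.card_eq_sum_card_fiberwise (f := fun p : ι × ι => p.1) (t := S)
    (fun p hp => (Finset.mem_product.1 (Finset.mem_filter.1 hp).1).1)]
  calc ∑ x ∈ S, (((S ×ˢ S).filter fun p : ι × ι => p.1 ≠ p.2 ∧ f p.1 = f p.2).filter fun p => p.1 = x).card
      ≤ ∑ x ∈ S, M := Finset.sum_le_sum fun x hx => ?_
    _ = S.card * M := by rw [Finset.sum_const, smul_eq_mul]
  -- the partners of `x`: inject into the fibre of `x` minus `x` itself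
  have hsub : (((S ×ˢ S).filter fun p : ι × ι => p.1 ≠ p.2 ∧ f p.1 = f p.2).filter fun p => p.1 = x).image Prod.snd ⊆
      (S.filter fun x' => f x' = f x).erase x := by
    intro x' hx'
    obtain ⟨⟨a, b⟩, hp, rfl⟩ := Finset.mem_image.1 hx'
    simp only [Finset.mem_filter, Finset.mem_product] at hp
    obtain ⟨⟨⟨_, hb⟩, hne, hfe⟩, rfl⟩ := hp
    exact Finset.mem_erase.2 ⟨fun h => hne h.symm, Finset.mem_filter.2 ⟨hb, hfe.symm⟩⟩
  have hinj : Set.InjOn Prod.snd ((((S ×ˢ S).filter fun p : ι × ι => p.1 ≠ p.2 ∧ f p.1 = f p.2).filter fun p => p.1 = x) :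
      Set (ι × ι)) := by
    rintro ⟨a, b⟩ hab ⟨c, d⟩ hcd (h : b = d)
    simp only [Finset.coe_filter, Set.mem_setOf_eq] at hab hcd
    rw [hab.2, hcd.2, h]
  calc _ = ((((S ×ˢ S).filter fun p : ι × ι => p.1 ≠ p.2 ∧ f p.1 = f p.2).filter fun p => p.1 = x).image Prod.snd).card :=
        (Finset.card_image_of_injOn hinj).symm
    _ ≤ ((S.filter fun x' => f x' = f x).erase x).card := Finset.card_le_card hsub
    _ = (S.filter fun x' => f x' = f x).card - 1 := Finset.card_erase_of_mem (Finset.mem_filter.2 ⟨hx, rfl⟩)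
    _ ≤ M := by have := hM x hx; omega

variable [DecidableEq κ₁] [DecidableEq κ₂] [DecidableEq γ₁] [Fintype γ₁] [DecidableEq γ₂] [Fintype γ₂]

/-- The keys colliding on the pair `(x, x')`. [folklore] -/
def collKeys (K₁ : Finset κ₁) (K₂ : Finset κ₂) (h₁ : κ₁ → ι → γ₁) (h₂ : κ₂ → β → γ₂) (f : ι → β) (q : ι × ι) :
    Finset (κ₁ × κ₂) :=
  (K₁ ×ˢ K₂).filter fun k => h₁ k.1 q.1 = h₁ k.1 q.2 ∧ h₂ k.2 (f q.1) = h₂ k.2 (f q.2)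

omit [DecidableEq β] [Fintype γ₁] [Fintype γ₂] in
/-- **Collisions fibrewise over the pair of points**: the colliding pairs of the doubly keyed map
are counted by summing, over `(x, x') ∈ S²`, the keys on which both hashes collide. [Arora–Barak
2009, proof of Lemma 21.26 ("the probability that `h = h'` times …")] [folklore] -/
theorem card_collisions_keyed₂_eq_sum (K₁ : Finset κ₁) (K₂ : Finset κ₂) (h₁ : κ₁ → ι → γ₁) (h₂ : κ₂ → β → γ₂)
    (f : ι → β) (S : Finset ι) :
    ((((K₁ ×ˢ K₂) ×ˢ S) ×ˢ ((K₁ ×ˢ K₂) ×ˢ S)).filter fun p => keyed₂ h₁ h₂ f p.1 = keyed₂ h₁ h₂ f p.2).card =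
      ∑ q ∈ S ×ˢ S, (collKeys K₁ K₂ h₁ h₂ f q).card := by
  classical
  set C := (((K₁ ×ˢ K₂) ×ˢ S) ×ˢ ((K₁ ×ˢ K₂) ×ˢ S)).filter fun p => keyed₂ h₁ h₂ f p.1 = keyed₂ h₁ h₂ f p.2 with hC
  rw [Finset.card_eq_sum_card_fiberwise (f := fun p : ((κ₁ × κ₂) × ι) × ((κ₁ × κ₂) × ι) => (p.1.2, p.2.2)) (t := S ×ˢ S)
    (fun p hp => by
      have hp' := (Finset.mem_filter.1 hp).1
      rw [Finset.mem_product] at hp'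
      exact Finset.mem_product.2 ⟨(Finset.mem_product.1 hp'.1).2, (Finset.mem_product.1 hp'.2).2⟩)]
  refine Finset.sum_congr rfl fun q hq => ?_
  obtain ⟨a, b⟩ := q
  rw [Finset.mem_product] at hq
  -- the fibre over `(a, b)` is the image of the colliding keys under `k ↦ ((k, a), (k, b))`
  have himg : C.filter (fun p => (p.1.2, p.2.2) = (a, b)) = (collKeys K₁ K₂ h₁ h₂ f (a, b)).image fun k => ((k, a), (k, b)) := by
    ext ⟨⟨k, x⟩, ⟨k', x'⟩⟩
    simp only [hC, collKeys, keyed₂, Finset.mem_filter, Finset.mem_product, Finset.mem_image, Prod.mk.injEq]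
    constructor
    · rintro ⟨⟨⟨⟨hk, _⟩, _, _⟩, hkk, hh₁, hh₂⟩, rfl, rfl⟩
      subst hkk
      exact ⟨k, ⟨hk, hh₁, hh₂⟩, ⟨rfl, rfl⟩, rfl, rfl⟩
    · rintro ⟨k₀, ⟨hk₀, hh₁, hh₂⟩, ⟨rfl, rfl⟩, rfl, rfl⟩
      exact ⟨⟨⟨⟨hk₀, hq.1⟩, hk₀, hq.2⟩, rfl, hh₁, hh₂⟩, rfl, rfl⟩
  rw [himg, Finset.card_image_of_injective]
  intro k k' h
  simp only [Prod.mk.injEq] at h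
  exact h.1.1

omit [DecidableEq ι] [DecidableEq β] [DecidableEq κ₁] [DecidableEq κ₂] [Fintype γ₁] [Fintype γ₂] in
/-- The colliding keys factor: `collKeys = {k₁ : h¹ collides on (x,x')} × {k₂ : h² collides on (f x, f x')}`.
[folklore] -/
theorem card_collKeys (K₁ : Finset κ₁) (K₂ : Finset κ₂) (h₁ : κ₁ → ι → γ₁) (h₂ : κ₂ → β → γ₂) (f : ι → β) (q : ι × ι) :
    (collKeys K₁ K₂ h₁ h₂ f q).card =
      (K₁.filter fun k => h₁ k q.1 = h₁ k q.2).card * (K₂.filter fun k => h₂ k (f q.1) = h₂ k (f q.2)).card := by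
  have h : collKeys K₁ K₂ h₁ h₂ f q = (K₁.filter fun k => h₁ k q.1 = h₁ k q.2) ×ˢ (K₂.filter fun k => h₂ k (f q.1) = h₂ k (f q.2)) := by
    ext ⟨k₁, k₂⟩
    simp only [collKeys, Finset.mem_filter, Finset.mem_product]
    tauto
  rw [h, Finset.card_product]

/-- **Collision count of the doubly keyed hash of a flat source.** For `h¹` pairwise independent on
`S` and `h²` pairwise independent on `f(S)`:
`#collisions · |γ₁||γ₂| ≤ |K₁||K₂| · (|S||γ₁||γ₂| + C_f|γ₂| + |S|²)` — the three terms count the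
pairs `x = x'`, the same-fibre pairs `x ≠ x'`, `f x = f x'` (second hash always collides), and the
pairs in distinct fibres (both hashes collide independently). [Arora–Barak 2009, Lemma 21.26
(proof technique); Liu–Pass 2020, Appendix (proof of Lemma 5.3)] [folklore] -/
theorem card_collisions_keyed₂_mul_le {K₁ : Finset κ₁} {K₂ : Finset κ₂} {h₁ : κ₁ → ι → γ₁} {h₂ : κ₂ → β → γ₂}
    {f : ι → β} {S : Finset ι} (hK₁ : IsPairwiseIndep K₁ h₁ S) (hK₂ : IsPairwiseIndep K₂ h₂ (S.image f)) :
    ((((K₁ ×ˢ K₂) ×ˢ S) ×ˢ ((K₁ ×ˢ K₂) ×ˢ S)).filter fun p => keyed₂ h₁ h₂ f p.1 = keyed₂ h₁ h₂ f p.2).card *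
        (Fintype.card γ₁ * Fintype.card γ₂) ≤
      K₁.card * K₂.card * (S.card * (Fintype.card γ₁ * Fintype.card γ₂) + fibreColl S f * Fintype.card γ₂ + S.card ^ 2) := by
  classical
  rw [card_collisions_keyed₂_eq_sum, Finset.sum_mul]
  set G₁ := Fintype.card γ₁ with hG₁
  set G₂ := Fintype.card γ₂ with hG₂
  set g : ι × ι → ℕ := fun q => (collKeys K₁ K₂ h₁ h₂ f q).card * (G₁ * G₂) with hg
  -- pointwise values on the three classes of pairs
  have hdiag : ∀ q ∈ (S ×ˢ S).filter (fun q : ι × ι => q.1 = q.2), g q = K₁.card * K₂.card * (G₁ * G₂) := by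
    intro q hq
    obtain ⟨_, he⟩ := Finset.mem_filter.1 hq
    have e1 : (K₁.filter fun k => h₁ k q.1 = h₁ k q.2) = K₁ := Finset.filter_true_of_mem fun k _ => by rw [he]
    have e2 : (K₂.filter fun k => h₂ k (f q.1) = h₂ k (f q.2)) = K₂ := Finset.filter_true_of_mem fun k _ => by rw [he]
    simp only [hg, card_collKeys, e1, e2]
  have hfib : ∀ q ∈ ((S ×ˢ S).filter (fun q : ι × ι => ¬ q.1 = q.2)).filter (fun q : ι × ι => f q.1 = f q.2),
      g q = K₁.card * K₂.card * G₂ := by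
    intro q hq
    obtain ⟨hq', hfe⟩ := Finset.mem_filter.1 hq
    obtain ⟨hqS, hne⟩ := Finset.mem_filter.1 hq'
    rw [Finset.mem_product] at hqS
    have h1 := hK₁.card_collide hqS.1 hqS.2 hne
    have e2 : (K₂.filter fun k => h₂ k (f q.1) = h₂ k (f q.2)) = K₂ := Finset.filter_true_of_mem fun k _ => by rw [hfe]
    simp only [hg, card_collKeys, e2]
    calc (K₁.filter fun k => h₁ k q.1 = h₁ k q.2).card * K₂.card * (G₁ * G₂)
        = ((K₁.filter fun k => h₁ k q.1 = h₁ k q.2).card * G₁) * K₂.card * G₂ := by ring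
      _ = K₁.card * K₂.card * G₂ := by rw [h1]
  have hoff : ∀ q ∈ ((S ×ˢ S).filter (fun q : ι × ι => ¬ q.1 = q.2)).filter (fun q : ι × ι => ¬ f q.1 = f q.2),
      g q = K₁.card * K₂.card := by
    intro q hq
    obtain ⟨hq', hfe⟩ := Finset.mem_filter.1 hq
    obtain ⟨hqS, hne⟩ := Finset.mem_filter.1 hq'
    rw [Finset.mem_product] at hqS
    have h1 := hK₁.card_collide hqS.1 hqS.2 hne
    have h2 := hK₂.card_collide (Finset.mem_image_of_mem f hqS.1) (Finset.mem_image_of_mem f hqS.2) hfe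
    simp only [hg, card_collKeys]
    calc (K₁.filter fun k => h₁ k q.1 = h₁ k q.2).card * (K₂.filter fun k => h₂ k (f q.1) = h₂ k (f q.2)).card * (G₁ * G₂)
        = ((K₁.filter fun k => h₁ k q.1 = h₁ k q.2).card * G₁) * ((K₂.filter fun k => h₂ k (f q.1) = h₂ k (f q.2)).card * G₂) := by
          ring
      _ = K₁.card * K₂.card := by rw [h1, h2]
  -- split the sum
  rw [← Finset.sum_filter_add_sum_filter_not (S ×ˢ S) (fun q : ι × ι => q.1 = q.2) g,
    ← Finset.sum_filter_add_sum_filter_not ((S ×ˢ S).filter fun q : ι × ι => ¬ q.1 = q.2) (fun q : ι × ι => f q.1 = f q.2) g,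
    Finset.sum_congr rfl hdiag, Finset.sum_congr rfl hfib, Finset.sum_congr rfl hoff,
    Finset.sum_const, Finset.sum_const, Finset.sum_const, smul_eq_mul, smul_eq_mul, smul_eq_mul]
  -- the three cardinalities
  have hcd : ((S ×ˢ S).filter fun q : ι × ι => q.1 = q.2).card = S.card := by
    have heq : ((S ×ˢ S).filter fun q : ι × ι => q.1 = q.2) = S.image fun x => (x, x) := by
      ext ⟨a, b⟩
      simp only [Finset.mem_filter, Finset.mem_product, Finset.mem_image, Prod.mk.injEq]
      constructor
      · rintro ⟨⟨ha, _⟩, rfl⟩; exact ⟨a, ha, rfl, rfl⟩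
      · rintro ⟨x, hx, rfl, rfl⟩; exact ⟨⟨hx, hx⟩, rfl⟩
    rw [heq, Finset.card_image_of_injective _ (fun x y h => congrArg Prod.fst h)]
  have hcf : (((S ×ˢ S).filter fun q : ι × ι => ¬ q.1 = q.2).filter fun q : ι × ι => f q.1 = f q.2).card = fibreColl S f := by
    unfold fibreColl
    rw [Finset.filter_filter]
  have hco : (((S ×ˢ S).filter fun q : ι × ι => ¬ q.1 = q.2).filter fun q : ι × ι => ¬ f q.1 = f q.2).card ≤ S.card ^ 2 :=
    (Finset.card_le_card ((Finset.filter_subset _ _).trans (Finset.filter_subset _ _))).trans (by rw [Finset.card_product, sq])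
  rw [hcd, hcf]
  calc S.card * (K₁.card * K₂.card * (G₁ * G₂)) + (fibreColl S f * (K₁.card * K₂.card * G₂) +
        (((S ×ˢ S).filter fun q : ι × ι => ¬ q.1 = q.2).filter fun q : ι × ι => ¬ f q.1 = f q.2).card * (K₁.card * K₂.card))
      ≤ S.card * (K₁.card * K₂.card * (G₁ * G₂)) + (fibreColl S f * (K₁.card * K₂.card * G₂) + S.card ^ 2 * (K₁.card * K₂.card)) := by
        gcongr
    _ = K₁.card * K₂.card * (S.card * (G₁ * G₂) + fibreColl S f * G₂ + S.card ^ 2) := by ring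

/-- **Joint Leftover Hash Lemma (flat source, two independent pairwise independent families, the
second applied after `f`).** For `X` uniform on `S ≠ ∅`, `h¹` pairwise independent on `S` into `γ₁`,
`h²` pairwise independent on `f(S)` into `γ₂`, and `C_f ≤ |S|·M`:
`Δ(((K₁,K₂), h¹_{K₁}(X), h²_{K₂}(f X)), U_{K₁ × K₂ × γ₁ × γ₂}) ≤ ½ √((|γ₁||γ₂| + |γ₂| M) / |S|)`.
[Arora–Barak 2009, Lemma 21.26; Liu–Pass 2020, Appendix (density in the proof of Lemma 5.3)]
[folklore] -/
theorem leftoverHash_joint {K₁ : Finset κ₁} {K₂ : Finset κ₂} (hK₁ne : K₁.Nonempty) (hK₂ne : K₂.Nonempty)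
    {h₁ : κ₁ → ι → γ₁} {h₂ : κ₂ → β → γ₂} {f : ι → β} {S : Finset ι} [Nonempty γ₁] [Nonempty γ₂] (hS : S.Nonempty)
    (hK₁ : IsPairwiseIndep K₁ h₁ S) (hK₂ : IsPairwiseIndep K₂ h₂ (S.image f)) {M : ℕ} (hM : fibreColl S f ≤ S.card * M) :
    distUnif ((K₁ ×ˢ K₂) ×ˢ S) (keyed₂ h₁ h₂ f) ((K₁ ×ˢ K₂) ×ˢ (Finset.univ : Finset (γ₁ × γ₂))) ≤
      2⁻¹ * Real.sqrt ((Fintype.card γ₁ * Fintype.card γ₂ + Fintype.card γ₂ * M) / S.card) := by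
  classical
  have hKc : (0 : ℝ) < (K₁.card : ℝ) * K₂.card := by
    have h1 : (0 : ℝ) < K₁.card := by exact_mod_cast hK₁ne.card_pos
    have h2 : (0 : ℝ) < K₂.card := by exact_mod_cast hK₂ne.card_pos
    positivity
  have hSc : (0 : ℝ) < S.card := by exact_mod_cast hS.card_pos
  have hγ₁ : (0 : ℝ) < Fintype.card γ₁ := by exact_mod_cast Fintype.card_pos
  have hγ₂ : (0 : ℝ) < Fintype.card γ₂ := by exact_mod_cast Fintype.card_pos
  have hmaps : ∀ p ∈ (K₁ ×ˢ K₂) ×ˢ S, keyed₂ h₁ h₂ f p ∈ (K₁ ×ˢ K₂) ×ˢ (Finset.univ : Finset (γ₁ × γ₂)) := fun p hp =>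
    Finset.mem_product.2 ⟨(Finset.mem_product.1 hp).1, Finset.mem_univ _⟩
  have hKne : (K₁ ×ˢ K₂).Nonempty := hK₁ne.product hK₂ne
  have hTne : ((K₁ ×ˢ K₂) ×ˢ (Finset.univ : Finset (γ₁ × γ₂))).Nonempty := hKne.product Finset.univ_nonempty
  refine (distUnif_le_sqrt (hKne.product hS) hTne hmaps).trans ?_
  refine mul_le_mul_of_nonneg_left (Real.sqrt_le_sqrt ?_) (by norm_num)
  -- `|T| · CP − 1 ≤ (|γ₁||γ₂| + |γ₂| M) / |S|`
  have hcoll := card_collisions_keyed₂_mul_le hK₁ hK₂ (f := f)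
  set C := ((((K₁ ×ˢ K₂) ×ˢ S) ×ˢ ((K₁ ×ˢ K₂) ×ˢ S)).filter fun p => keyed₂ h₁ h₂ f p.1 = keyed₂ h₁ h₂ f p.2).card with hC
  have hcollR : (C : ℝ) * (Fintype.card γ₁ * Fintype.card γ₂) ≤
      K₁.card * K₂.card * (S.card * (Fintype.card γ₁ * Fintype.card γ₂) + fibreColl S f * Fintype.card γ₂ + (S.card : ℝ) ^ 2) := by
    exact_mod_cast hcoll
  have hMR : (fibreColl S f : ℝ) ≤ S.card * M := by exact_mod_cast hM
  unfold collProb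
  rw [← hC]
  simp only [Finset.card_product, Finset.card_univ, Fintype.card_prod, Nat.cast_mul]
  rw [sub_le_iff_le_add]
  set k : ℝ := (K₁.card : ℝ) * K₂.card with hk
  set G : ℝ := (Fintype.card γ₁ : ℝ) * Fintype.card γ₂ with hG
  have hGpos : 0 < G := mul_pos hγ₁ hγ₂
  -- rewrite the left-hand side as `C·G / (k |S|²)`
  rw [show k * G * ((C : ℝ) / (k * (S.card : ℝ)) ^ 2) = (C : ℝ) * G / (k * S.card * S.card) by
    field_simp]
  rw [div_le_iff₀ (by positivity)]
  calc (C : ℝ) * G ≤ k * (S.card * G + fibreColl S f * Fintype.card γ₂ + (S.card : ℝ) ^ 2) := hcollR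
    _ ≤ k * (S.card * G + S.card * M * Fintype.card γ₂ + (S.card : ℝ) ^ 2) := by gcongr
    _ = ((G + Fintype.card γ₂ * M) / S.card + 1) * (k * S.card * S.card) := by
        field_simp

/-- **Joint LHL with fibre bound**: if every fibre of `f` in `S` has at most `P` points then
`Δ ≤ ½ √((|γ₁||γ₂| + |γ₂| (P − 1)) / |S|)`. [Arora–Barak 2009, Lemma 21.26; Liu–Pass 2020, Appendix]
[folklore] -/
theorem leftoverHash_joint_of_fibre_le {K₁ : Finset κ₁} {K₂ : Finset κ₂} (hK₁ne : K₁.Nonempty) (hK₂ne : K₂.Nonempty)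
    {h₁ : κ₁ → ι → γ₁} {h₂ : κ₂ → β → γ₂} {f : ι → β} {S : Finset ι} [Nonempty γ₁] [Nonempty γ₂] (hS : S.Nonempty)
    (hK₁ : IsPairwiseIndep K₁ h₁ S) (hK₂ : IsPairwiseIndep K₂ h₂ (S.image f)) {P : ℕ}
    (hP : ∀ x ∈ S, (S.filter fun x' => f x' = f x).card ≤ P) :
    distUnif ((K₁ ×ˢ K₂) ×ˢ S) (keyed₂ h₁ h₂ f) ((K₁ ×ˢ K₂) ×ˢ (Finset.univ : Finset (γ₁ × γ₂))) ≤
      2⁻¹ * Real.sqrt ((Fintype.card γ₁ * Fintype.card γ₂ + Fintype.card γ₂ * (P - 1 : ℕ)) / S.card) := by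
  refine leftoverHash_joint hK₁ne hK₂ne hS hK₁ hK₂ (fibreColl_le fun x hx => ?_)
  have := hP x hx
  have h1 : 1 ≤ (S.filter fun x' => f x' = f x).card := Finset.card_pos.2 ⟨x, Finset.mem_filter.2 ⟨hx, rfl⟩⟩
  omega

/-! #### The sharp count (exact bookkeeping of the pairs in distinct fibres) -/

/-- **Exact collision count of the doubly keyed hash**: with `C` the number of colliding pairs,
`C·|γ₁||γ₂| + |K₁||K₂|·(|S| + C_f) = |K₁||K₂|·(|S||γ₁||γ₂| + C_f|γ₂| + |S|²)` — i.e.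
`C·|γ₁||γ₂| = |K₁||K₂|·(|S||γ₁||γ₂| + C_f|γ₂| + (|S|² − |S| − C_f))`, the last summand being the
exact number of pairs in distinct fibres (each colliding under `|K₁||K₂|/(|γ₁||γ₂|)` keys). This
sharpens `card_collisions_keyed₂_mul_le`, which over-counts those pairs by `|S| + C_f`; the
difference matters when most pairs lie in a common fibre (e.g. `|γ₂| = 1`). [Arora–Barak 2009,
Lemma 21.26 (proof technique)] [folklore] -/
theorem card_collisions_keyed₂_sharp {K₁ : Finset κ₁} {K₂ : Finset κ₂} {h₁ : κ₁ → ι → γ₁} {h₂ : κ₂ → β → γ₂}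
    {f : ι → β} {S : Finset ι} (hK₁ : IsPairwiseIndep K₁ h₁ S) (hK₂ : IsPairwiseIndep K₂ h₂ (S.image f)) :
    ((((K₁ ×ˢ K₂) ×ˢ S) ×ˢ ((K₁ ×ˢ K₂) ×ˢ S)).filter fun p => keyed₂ h₁ h₂ f p.1 = keyed₂ h₁ h₂ f p.2).card *
        (Fintype.card γ₁ * Fintype.card γ₂) + K₁.card * K₂.card * (S.card + fibreColl S f) =
      K₁.card * K₂.card * (S.card * (Fintype.card γ₁ * Fintype.card γ₂) + fibreColl S f * Fintype.card γ₂ + S.card ^ 2) := by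
  classical
  rw [card_collisions_keyed₂_eq_sum, Finset.sum_mul]
  set G₁ := Fintype.card γ₁ with hG₁
  set G₂ := Fintype.card γ₂ with hG₂
  set g : ι × ι → ℕ := fun q => (collKeys K₁ K₂ h₁ h₂ f q).card * (G₁ * G₂) with hg
  have hdiag : ∀ q ∈ (S ×ˢ S).filter (fun q : ι × ι => q.1 = q.2), g q = K₁.card * K₂.card * (G₁ * G₂) := by
    intro q hq
    obtain ⟨_, he⟩ := Finset.mem_filter.1 hq
    have e1 : (K₁.filter fun k => h₁ k q.1 = h₁ k q.2) = K₁ := Finset.filter_true_of_mem fun k _ => by rw [he]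
    have e2 : (K₂.filter fun k => h₂ k (f q.1) = h₂ k (f q.2)) = K₂ := Finset.filter_true_of_mem fun k _ => by rw [he]
    simp only [hg, card_collKeys, e1, e2]
  have hfib : ∀ q ∈ ((S ×ˢ S).filter (fun q : ι × ι => ¬ q.1 = q.2)).filter (fun q : ι × ι => f q.1 = f q.2),
      g q = K₁.card * K₂.card * G₂ := by
    intro q hq
    obtain ⟨hq', hfe⟩ := Finset.mem_filter.1 hq
    obtain ⟨hqS, hne⟩ := Finset.mem_filter.1 hq'
    rw [Finset.mem_product] at hqS
    have h1 := hK₁.card_collide hqS.1 hqS.2 hne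
    have e2 : (K₂.filter fun k => h₂ k (f q.1) = h₂ k (f q.2)) = K₂ := Finset.filter_true_of_mem fun k _ => by rw [hfe]
    simp only [hg, card_collKeys, e2]
    calc (K₁.filter fun k => h₁ k q.1 = h₁ k q.2).card * K₂.card * (G₁ * G₂)
        = ((K₁.filter fun k => h₁ k q.1 = h₁ k q.2).card * G₁) * K₂.card * G₂ := by ring
      _ = K₁.card * K₂.card * G₂ := by rw [h1]
  have hoff : ∀ q ∈ ((S ×ˢ S).filter (fun q : ι × ι => ¬ q.1 = q.2)).filter (fun q : ι × ι => ¬ f q.1 = f q.2),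
      g q = K₁.card * K₂.card := by
    intro q hq
    obtain ⟨hq', hfe⟩ := Finset.mem_filter.1 hq
    obtain ⟨hqS, hne⟩ := Finset.mem_filter.1 hq'
    rw [Finset.mem_product] at hqS
    have h1 := hK₁.card_collide hqS.1 hqS.2 hne
    have h2 := hK₂.card_collide (Finset.mem_image_of_mem f hqS.1) (Finset.mem_image_of_mem f hqS.2) hfe
    simp only [hg, card_collKeys]
    calc (K₁.filter fun k => h₁ k q.1 = h₁ k q.2).card * (K₂.filter fun k => h₂ k (f q.1) = h₂ k (f q.2)).card * (G₁ * G₂)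
        = ((K₁.filter fun k => h₁ k q.1 = h₁ k q.2).card * G₁) * ((K₂.filter fun k => h₂ k (f q.1) = h₂ k (f q.2)).card * G₂) := by
          ring
      _ = K₁.card * K₂.card := by rw [h1, h2]
  rw [← Finset.sum_filter_add_sum_filter_not (S ×ˢ S) (fun q : ι × ι => q.1 = q.2) g,
    ← Finset.sum_filter_add_sum_filter_not ((S ×ˢ S).filter fun q : ι × ι => ¬ q.1 = q.2) (fun q : ι × ι => f q.1 = f q.2) g,
    Finset.sum_congr rfl hdiag, Finset.sum_congr rfl hfib, Finset.sum_congr rfl hoff,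
    Finset.sum_const, Finset.sum_const, Finset.sum_const, smul_eq_mul, smul_eq_mul, smul_eq_mul]
  -- the three cardinalities, the last one exactly
  have hcd : ((S ×ˢ S).filter fun q : ι × ι => q.1 = q.2).card = S.card := by
    have heq : ((S ×ˢ S).filter fun q : ι × ι => q.1 = q.2) = S.image fun x => (x, x) := by
      ext ⟨a, b⟩
      simp only [Finset.mem_filter, Finset.mem_product, Finset.mem_image, Prod.mk.injEq]
      constructor
      · rintro ⟨⟨ha, _⟩, rfl⟩; exact ⟨a, ha, rfl, rfl⟩
      · rintro ⟨x, hx, rfl, rfl⟩; exact ⟨⟨hx, hx⟩, rfl⟩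
    rw [heq, Finset.card_image_of_injective _ (fun x y h => congrArg Prod.fst h)]
  have hcf : (((S ×ˢ S).filter fun q : ι × ι => ¬ q.1 = q.2).filter fun q : ι × ι => f q.1 = f q.2).card = fibreColl S f := by
    unfold fibreColl
    rw [Finset.filter_filter]
  have hpart₁ := Finset.card_filter_add_card_filter_not (s := S ×ˢ S) (fun q : ι × ι => q.1 = q.2)
  have hpart₂ := Finset.card_filter_add_card_filter_not (s := (S ×ˢ S).filter fun q : ι × ι => ¬ q.1 = q.2)
    (fun q : ι × ι => f q.1 = f q.2)
  rw [Finset.card_product, hcd] at hpart₁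
  rw [hcf] at hpart₂
  set N₃ := (((S ×ˢ S).filter fun q : ι × ι => ¬ q.1 = q.2).filter fun q : ι × ι => ¬ f q.1 = f q.2).card with hN₃
  rw [hcd, hcf]
  have hN : S.card + (fibreColl S f + N₃) = S.card * S.card := by omega
  calc S.card * (K₁.card * K₂.card * (G₁ * G₂)) + (fibreColl S f * (K₁.card * K₂.card * G₂) + N₃ * (K₁.card * K₂.card)) +
        K₁.card * K₂.card * (S.card + fibreColl S f)
      = K₁.card * K₂.card * (S.card * (G₁ * G₂) + fibreColl S f * G₂ + (S.card + (fibreColl S f + N₃))) := by ring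
    _ = K₁.card * K₂.card * (S.card * (G₁ * G₂) + fibreColl S f * G₂ + S.card ^ 2) := by rw [hN, sq]

/-- **Joint Leftover Hash Lemma, sharp form**: for `X` uniform on `S ≠ ∅`, `h¹` pairwise
independent on `S` into `γ₁`, `h²` pairwise independent on `f(S)` into `γ₂`, and `C_f ≤ |S|·M`:
`Δ ≤ ½ √((|γ₁||γ₂| + (|γ₂| − 1)·M) / |S|)`. For `|γ₂| = 1` (nothing extracted from `f x`) the
fibre structure of `f` is invisible, as it should be. [Arora–Barak 2009, Lemma 21.26; Liu–Pass
2020, Appendix (density in the proof of Lemma 5.3)] [folklore] -/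
theorem leftoverHash_joint_sharp {K₁ : Finset κ₁} {K₂ : Finset κ₂} (hK₁ne : K₁.Nonempty) (hK₂ne : K₂.Nonempty)
    {h₁ : κ₁ → ι → γ₁} {h₂ : κ₂ → β → γ₂} {f : ι → β} {S : Finset ι} [Nonempty γ₁] [Nonempty γ₂] (hS : S.Nonempty)
    (hK₁ : IsPairwiseIndep K₁ h₁ S) (hK₂ : IsPairwiseIndep K₂ h₂ (S.image f)) {M : ℕ} (hM : fibreColl S f ≤ S.card * M) :
    distUnif ((K₁ ×ˢ K₂) ×ˢ S) (keyed₂ h₁ h₂ f) ((K₁ ×ˢ K₂) ×ˢ (Finset.univ : Finset (γ₁ × γ₂))) ≤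
      2⁻¹ * Real.sqrt ((Fintype.card γ₁ * Fintype.card γ₂ + (Fintype.card γ₂ - 1) * M) / S.card) := by
  classical
  have hKc : (0 : ℝ) < (K₁.card : ℝ) * K₂.card := by
    have h1 : (0 : ℝ) < K₁.card := by exact_mod_cast hK₁ne.card_pos
    have h2 : (0 : ℝ) < K₂.card := by exact_mod_cast hK₂ne.card_pos
    positivity
  have hSc : (0 : ℝ) < S.card := by exact_mod_cast hS.card_pos
  have hγ₁ : (0 : ℝ) < Fintype.card γ₁ := by exact_mod_cast Fintype.card_pos
  have hγ₂ : (1 : ℝ) ≤ Fintype.card γ₂ := by exact_mod_cast Fintype.card_pos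
  have hmaps : ∀ p ∈ (K₁ ×ˢ K₂) ×ˢ S, keyed₂ h₁ h₂ f p ∈ (K₁ ×ˢ K₂) ×ˢ (Finset.univ : Finset (γ₁ × γ₂)) := fun p hp =>
    Finset.mem_product.2 ⟨(Finset.mem_product.1 hp).1, Finset.mem_univ _⟩
  have hKne : (K₁ ×ˢ K₂).Nonempty := hK₁ne.product hK₂ne
  have hTne : ((K₁ ×ˢ K₂) ×ˢ (Finset.univ : Finset (γ₁ × γ₂))).Nonempty := hKne.product Finset.univ_nonempty
  refine (distUnif_le_sqrt (hKne.product hS) hTne hmaps).trans ?_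
  refine mul_le_mul_of_nonneg_left (Real.sqrt_le_sqrt ?_) (by norm_num)
  have hcoll := card_collisions_keyed₂_sharp hK₁ hK₂ (f := f)
  set C := ((((K₁ ×ˢ K₂) ×ˢ S) ×ˢ ((K₁ ×ˢ K₂) ×ˢ S)).filter fun p => keyed₂ h₁ h₂ f p.1 = keyed₂ h₁ h₂ f p.2).card with hC
  have hcollR : (C : ℝ) * (Fintype.card γ₁ * Fintype.card γ₂) + K₁.card * K₂.card * (S.card + fibreColl S f) =
      K₁.card * K₂.card * (S.card * (Fintype.card γ₁ * Fintype.card γ₂) + fibreColl S f * Fintype.card γ₂ + (S.card : ℝ) ^ 2) := by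
    exact_mod_cast hcoll
  have hMR : (fibreColl S f : ℝ) ≤ S.card * M := by exact_mod_cast hM
  have hCf0 : (0 : ℝ) ≤ fibreColl S f := Nat.cast_nonneg _
  unfold collProb
  rw [← hC]
  simp only [Finset.card_product, Finset.card_univ, Fintype.card_prod, Nat.cast_mul]
  rw [sub_le_iff_le_add]
  set k : ℝ := (K₁.card : ℝ) * K₂.card with hk
  set G : ℝ := (Fintype.card γ₁ : ℝ) * Fintype.card γ₂ with hG
  rw [show k * G * ((C : ℝ) / (k * (S.card : ℝ)) ^ 2) = (C : ℝ) * G / (k * S.card * S.card) by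
    field_simp]
  rw [div_le_iff₀ (by positivity)]
  -- `C·G = k (|S| G + C_f γ₂ + |S|² − |S| − C_f)` and `C_f (γ₂ − 1) ≤ |S| M (γ₂ − 1)`
  have hCG : (C : ℝ) * G = k * (S.card * G + fibreColl S f * Fintype.card γ₂ + (S.card : ℝ) ^ 2) - k * (S.card + fibreColl S f) := by
    rw [← hcollR]; ring
  rw [hCG]
  have hkey : (fibreColl S f : ℝ) * Fintype.card γ₂ - fibreColl S f ≤ S.card * M * Fintype.card γ₂ - S.card * M := by
    have : (fibreColl S f : ℝ) * (Fintype.card γ₂ - 1) ≤ S.card * M * (Fintype.card γ₂ - 1) :=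
      mul_le_mul_of_nonneg_right hMR (by linarith)
    linarith
  have hk0 : 0 ≤ k := hKc.le
  calc k * (S.card * G + fibreColl S f * Fintype.card γ₂ + (S.card : ℝ) ^ 2) - k * (S.card + fibreColl S f)
      = k * (S.card * G + (fibreColl S f * Fintype.card γ₂ - fibreColl S f) + (S.card : ℝ) ^ 2 - S.card) := by ring
    _ ≤ k * (S.card * G + (S.card * M * Fintype.card γ₂ - S.card * M) + (S.card : ℝ) ^ 2 - 0) := by
        gcongr
    _ = ((G + (Fintype.card γ₂ - 1) * M) / S.card + 1) * (k * S.card * S.card) := by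
        field_simp
        ring

/-- **Sharp joint LHL with fibre bound**: if every fibre of `f` in `S` has at most `P` points then
`Δ ≤ ½ √((|γ₁||γ₂| + (|γ₂| − 1)(P − 1)) / |S|)`. [Arora–Barak 2009, Lemma 21.26; Liu–Pass 2020,
Appendix] [folklore] -/
theorem leftoverHash_joint_sharp_of_fibre_le {K₁ : Finset κ₁} {K₂ : Finset κ₂} (hK₁ne : K₁.Nonempty) (hK₂ne : K₂.Nonempty)
    {h₁ : κ₁ → ι → γ₁} {h₂ : κ₂ → β → γ₂} {f : ι → β} {S : Finset ι} [Nonempty γ₁] [Nonempty γ₂] (hS : S.Nonempty)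
    (hK₁ : IsPairwiseIndep K₁ h₁ S) (hK₂ : IsPairwiseIndep K₂ h₂ (S.image f)) {P : ℕ}
    (hP : ∀ x ∈ S, (S.filter fun x' => f x' = f x).card ≤ P) :
    distUnif ((K₁ ×ˢ K₂) ×ˢ S) (keyed₂ h₁ h₂ f) ((K₁ ×ˢ K₂) ×ˢ (Finset.univ : Finset (γ₁ × γ₂))) ≤
      2⁻¹ * Real.sqrt ((Fintype.card γ₁ * Fintype.card γ₂ + (Fintype.card γ₂ - 1) * (P - 1 : ℕ)) / S.card) := by
  refine leftoverHash_joint_sharp hK₁ne hK₂ne hS hK₁ hK₂ (fibreColl_le fun x hx => ?_)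
  have := hP x hx
  have h1 : 1 ≤ (S.filter fun x' => f x' = f x).card := Finset.card_pos.2 ⟨x, Finset.mem_filter.2 ⟨hx, rfl⟩⟩
  omega

end Joint

/-! ### Re-indexing the target -/

section Target

variable {ι β β' : Type*} [DecidableEq β] [DecidableEq β']

/-- An injective recoding of the values changes neither the fibre probabilities … [folklore] -/
theorem prob_comp_of_injective (S : Finset ι) (g : ι → β) {e : β → β'} (he : Function.Injective e) (v : β) :
    prob S (e ∘ g) (e v) = prob S g v := by
  unfold prob fib
  have h : (S.filter fun x => (e ∘ g) x = e v) = S.filter fun x => g x = v := by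
    ext x
    simp only [Finset.mem_filter, Function.comp_apply, he.eq_iff]
  rw [h]

/-- … nor the distance from uniform (target recoded along). [folklore] -/
theorem distUnif_comp_of_injective (S : Finset ι) (g : ι → β) {e : β → β'} (he : Function.Injective e) (T : Finset β) :
    distUnif S (e ∘ g) (T.image e) = distUnif S g T := by
  unfold distUnif
  rw [Finset.card_image_of_injective T he, Finset.sum_image (fun x _ y _ h => he h)]
  congr 1
  exact Finset.sum_congr rfl fun v _ => by rw [prob_comp_of_injective S g he]

end Target

end LeftoverHash

end Literature.Computability.Cryptography
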